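import Mathlib
import HarnessLib.Audit
import Summits.PneNP.PneNP.Theorems.PstarUnionCaseBTwo
import Summits.PneNP.PneNP.Theorems.PstarUnionCaseBAlign
import Summits.PneNP.PneNP.Theorems.PstarUnionBridgeData
import Summits.PneNP.PneNP.Theorems.PstarUnionTrichotomy

/-!
# Case B of the union lemma with at least two chords: `#J₀ ≤ 5` (ROUND-24, memo §14.21–§14.24; toward `CaseBFive`)

FRONTIER range-avoidance ladder, rung F-N3, ROUND 24 (cell `pnp-ideate`, planner memo `r24/CORE-BOUND-NOTES.md` §14.21–§14.24 (planner p3 g22); restricted-model proof complexity —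
nothing here bears on `P` versus `NP`).

**`caseB_two_chords`**: a union-terminal core with admissible `F`, hun, `w₂` reading a chord private, and AT LEAST TWO chords has `#J₀ ≤ 5`.  Assembly:

1. B-I (`PstarUnionCaseBReads.chords_read_of_one`): `w₂` reads every chord; B-II (`PstarUnionCaseBAlign.alignment`): `Aᵢ.1 ∩ privates = εᵢ·(w₂.1 ∩ privates)`;
2. if some reader is released by no output, the other pair is TERMINAL and the landed chain `PstarCoreBoundTargets.card_le_five_of_terminal'` applies;
3. otherwise the EFFECTIVE READERS `Rᵢ := Aᵢ + εᵢ·w₂` (`exists_effReader`: chord-blind, same solvability as `Aᵢ` given `w₂ = t₂`) package with `w₂` as bridge data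
   (`PstarUnionBridgeData.exists_bridgeData_of_sat`), and `reader_dichotomy` runs `PstarUnionCaseBTwo.card_le_five_caseB_dir` unless the reader's form is constant on
   the cube — in which case no CHORD releases it; both readers constant contradicts the cover at a chord.

What remains of `CaseBFive` after this file is the SINGLE-CHORD world (`J₀ = D c₀ + c₀` one cycle, `w₂` reading `c₀`).
-/

set_option linter.dupNamespace false -- `Summit.PneNP.PneNP.…`: summit = sub-problem name (D-0017 single-conjunct layout)

open Finset Module Literature.Computability.Complexity
open scoped symmDiff
open Summit.PneNP.PneNP.Theorems.PstarFibrePolys (bit bit_injective bit_xor)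
open Summit.PneNP.PneNP.Theorems.PstarTyped (Typed)
open Summit.PneNP.PneNP.Theorems.PstarSALevel (varSet bdry BoundaryExpanding SimpleOverlap)
open Summit.PneNP.PneNP.Theorems.PstarCoreBound (XorClosed)
open Summit.PneNP.PneNP.Theorems.PstarGapOneAll (gval)
open Summit.PneNP.PneNP.Theorems.PstarXCore (xverts)
open Summit.PneNP.PneNP.Theorems.PstarGSystemFreeVar (gval_symmDiff)
open Summit.PneNP.PneNP.Theorems.PstarChordRepair (IsChord)
open Summit.PneNP.PneNP.Theorems.PstarChordBridgeTools
open Summit.PneNP.PneNP.Theorems.PstarChordBridge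
open Summit.PneNP.PneNP.Theorems.PstarChordBridgeForcing (coef_of_unread)
open Summit.PneNP.PneNP.Theorems.PstarChordBridgeCotree (Peelable sdiff_nonempty_of_xorClosed)
open Summit.PneNP.PneNP.Theorems.PstarChordBridgeTerminal (HasConstraints)
open Summit.PneNP.PneNP.Theorems.PstarCoreBoundTargets (Terminal card_le_five_of_terminal')
open Summit.PneNP.PneNP.Theorems.PstarUnion (SatPair UnionTerminal)
open Summit.PneNP.PneNP.Theorems.PstarUnionTrichotomy (terminal_of_cover₀ terminal_of_cover₁)
open Summit.PneNP.PneNP.Theorems.PstarUnionBridgeData (exists_bridgeData_of_sat)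
open Summit.PneNP.PneNP.Theorems.PstarUnionCaseBReads (chords_read_of_one)
open Summit.PneNP.PneNP.Theorems.PstarUnionCaseBAlign (alignment)
open Summit.PneNP.PneNP.Theorems.PstarUnionCaseBTwo (card_le_five_caseB_dir)

namespace Summit.PneNP.PneNP.Theorems.PstarUnionCaseBFiveTwo

variable {n m : ℕ}

/-! ## Effective readers -/

/-- **The effective reader `A + ε·w₂`**: under alignment it is chord-blind, its monomials are among those of `A` and `w₂`, and given `w₂ = t₂` it is satisfied iff `A` is. -/
theorem exists_effReader (I : LocalMap 4 n m) {J₀ F : Finset (Fin m)} (A w₂ : Finset (Fin n) × Finset (Fin m) × Bool) (ε : Bool)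
    (hal : ∀ c ∈ J₀ \ F, A.1 ∩ {I.vars c 2, I.vars c 3} = (if ε then w₂.1 ∩ {I.vars c 2, I.vars c 3} else ∅)) :
    ∃ R : Finset (Fin n) × Finset (Fin m) × Bool,
      (∀ v ∈ privs I (J₀ \ F), v ∉ R.1) ∧ R.2.1 ⊆ A.2.1 ∪ w₂.2.1 ∧
      (∀ z : Fin n → Bool, gval I w₂.1 w₂.2.1 z = w₂.2.2 → (gval I A.1 A.2.1 z = A.2.2 ↔ gval I R.1 R.2.1 z = R.2.2)) := by
  classical
  have hpair : ∀ v ∈ privs I (J₀ \ F), ∃ c ∈ J₀ \ F, v ∈ ({I.vars c 2, I.vars c 3} : Finset (Fin n)) := by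
    intro v hv
    obtain ⟨c, hc, h⟩ := (mem_privs I).1 hv
    refine ⟨c, hc, ?_⟩
    rw [mem_insert, mem_singleton]
    rcases h with h | h
    · exact Or.inl h.symm
    · exact Or.inr h.symm
  cases ε with
  | false =>
    refine ⟨A, fun v hv hvA => ?_, subset_union_left, fun z _ => Iff.rfl⟩
    obtain ⟨c, hc, hvP⟩ := hpair v hv
    have h := hal c hc
    rw [if_neg Bool.false_ne_true] at h
    have : v ∈ A.1 ∩ {I.vars c 2, I.vars c 3} := mem_inter.2 ⟨hvA, hvP⟩
    rw [h] at this
    exact notMem_empty v this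
  | true =>
    refine ⟨(A.1 ∆ w₂.1, A.2.1 ∆ w₂.2.1, xor A.2.2 w₂.2.2), fun v hv hvR => ?_, ?_, fun z hz => ?_⟩
    · obtain ⟨c, hc, hvP⟩ := hpair v hv
      have h := hal c hc
      rw [if_pos rfl] at h
      have hiff : v ∈ A.1 ↔ v ∈ w₂.1 := by
        constructor
        · intro hvA
          have : v ∈ A.1 ∩ {I.vars c 2, I.vars c 3} := mem_inter.2 ⟨hvA, hvP⟩
          rw [h] at this
          exact (mem_inter.1 this).1
        · intro hvw
          have : v ∈ w₂.1 ∩ {I.vars c 2, I.vars c 3} := mem_inter.2 ⟨hvw, hvP⟩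
          rw [← h] at this
          exact (mem_inter.1 this).1
      have hvR' : v ∈ A.1 ∆ w₂.1 := hvR
      rw [mem_symmDiff] at hvR'
      rcases hvR' with ⟨h1, h2⟩ | ⟨h1, h2⟩
      · exact h2 (hiff.1 h1)
      · exact h2 (hiff.2 h1)
    · show A.2.1 ∆ w₂.2.1 ⊆ A.2.1 ∪ w₂.2.1
      exact symmDiff_subset_union
    · show gval I A.1 A.2.1 z = A.2.2 ↔ gval I (A.1 ∆ w₂.1) (A.2.1 ∆ w₂.2.1) z = xor A.2.2 w₂.2.2
      rw [gval_symmDiff, hz]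
      cases gval I A.1 A.2.1 z <;> cases A.2.2 <;> cases w₂.2.2 <;> decide

/-! ## One reader: at most five outputs, or no chord releases it -/

/-- **Reader dichotomy.**  A chord-blind reader `R` and `w₂` reading every chord (both gate-free on the privates, monomials off the core, `#(J₀ ∪ G_R ∪ G₂) ≤ r`), `(R, w₂)`
unsolvable over `J₀` but satisfied together by some assignment, admissible `F` with at least two chords: then `#J₀ ≤ 5`, or no chord `c` releases `(R, w₂)`. -/
theorem reader_dichotomy (I : LocalMap 4 n m) (hI : I.IsPure xorAndPred) (hT : Typed I) (hS : SimpleOverlap I) {r : ℕ} (hE : BoundaryExpanding r I)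
    (y : Fin m → Bool) {J₀ : Finset (Fin m)} (hX : XorClosed I J₀) (hJr : J₀.card < r)
    {F : Finset (Fin m)} (hF : F ⊆ J₀) (hP : Peelable I F) (hmax : ∀ F', F ⊆ F' → F' ⊆ J₀ → Peelable I F' → F' = F)
    (hchord : ∀ e ∈ J₀ \ F, IsChord I J₀ e) (htwo : 2 ≤ (J₀ \ F).card)
    (R w₂ : Finset (Fin n) × Finset (Fin m) × Bool) (hdR : Disjoint J₀ R.2.1) (hd₂ : Disjoint J₀ w₂.2.1) (hcard : (J₀ ∪ R.2.1 ∪ w₂.2.1).card ≤ r)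
    (hun : ∀ g ∈ R.2.1 ∪ w₂.2.1, ∀ v ∈ privs I (J₀ \ F), I.vars g 2 ≠ v ∧ I.vars g 3 ≠ v)
    (hblind : ∀ v ∈ privs I (J₀ \ F), v ∉ R.1) (hreads : ∀ c ∈ J₀ \ F, I.vars c 2 ∈ w₂.1 ∨ I.vars c 3 ∈ w₂.1)
    (hT3 : ¬ SatPair I y J₀ R w₂) (hsat : ∃ z : Fin n → Bool, gval I R.1 R.2.1 z = R.2.2 ∧ gval I w₂.1 w₂.2.1 z = w₂.2.2) :
    J₀.card ≤ 5 ∨ ∀ c ∈ J₀ \ F, ¬ SatPair I y (J₀.erase c) R w₂ := by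
  classical
  have hcross : ∀ g ∈ R.2.1 ∪ w₂.2.1, ¬ (I.vars g 2 ∈ privs I (J₀ \ F) ∧ I.vars g 3 ∈ privs I (J₀ \ F)) :=
    fun g hg h => (hun g hg _ h.1).1 rfl
  have hT3' : ¬ ∃ z : Fin n → Bool, (∀ j ∈ J₀, I.eval z j = y j) ∧ gval I R.1 R.2.1 z = R.2.2 ∧ gval I w₂.1 w₂.2.1 z = w₂.2.2 := hT3
  obtain ⟨B, hy, hJ, hN, ⟨hC1, hG1, hb1, hC2, hG2, hb2⟩, hW, hL, -⟩ :=
    exists_bridgeData_of_sat I hI hT hS hE y hJr.le R w₂ hdR hd₂ hT3' hsat hF hP hmax hchord hcross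
  subst hy hJ
  have hFN : B.J₀ \ B.N = F := by rw [hN]; exact Finset.sdiff_sdiff_eq_self hF
  have hunB : ∀ v ∈ privs I B.N, (∀ g ∈ B.G₁, I.vars g 2 ≠ v ∧ I.vars g 3 ≠ v) ∧ ∀ g ∈ B.G₂, I.vars g 2 ≠ v ∧ I.vars g 3 ≠ v := by
    intro v hv
    rw [hN] at hv
    rw [hG1, hG2]
    exact ⟨fun g hg => hun g (mem_union_left _ hg) v hv, fun g hg => hun g (mem_union_right _ hg) v hv⟩
  have hblindB : ∀ v ∈ privs I B.N, v ∉ B.C₁ := by rw [hN, hC1]; exact hblind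
  have hreadsB : ∀ c ∈ B.N, I.vars c 2 ∈ B.C₂ ∨ I.vars c 3 ∈ B.C₂ := by rw [hN, hC2]; exact hreads
  have hT3B : ¬ ∃ z, Solution I B B.J₀ z := by
    rintro ⟨z, hz, h1, h2⟩
    rw [hC1, hG1, hb1] at h1
    rw [hC2, hG2, hb2] at h2
    exact hT3 ⟨z, hz, h1, h2⟩
  by_cases hZ : ∃ a, free I B.y (B.J₀ \ B.N) B.N B.T₁ B.C₁ B.G₁ a = bit B.b₁
  · left
    have hr' : (B.J₀ ∪ B.G₁ ∪ B.G₂).card ≤ r := by rw [hG1, hG2]; exact hcard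
    have hP' : Peelable I (B.J₀ \ B.N) := by rw [hFN]; exact hP
    have hG₁' : Disjoint B.G₁ B.J₀ := by rw [hG1]; exact hdR.symm
    have hG₂' : Disjoint B.G₂ B.J₀ := by rw [hG2]; exact hd₂.symm
    have hN2 : 2 ≤ B.N.card := by rw [hN]; exact htwo
    exact card_le_five_caseB_dir I hI hT hS hE hW hJr hr' hX hP' hG₁' hG₂' hN2 hL hunB hblindB hreadsB hT3B hZ
  · right
    rintro c hc ⟨z, hzK, hzR, hzw⟩
    apply hZ
    have hcN : c ∈ B.N := by rw [hN]; exact hc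
    have hzF : ∀ j ∈ B.J₀ \ B.N, I.eval z j = B.y j := fun j hj =>
      hzK j (mem_erase.2 ⟨fun h => (mem_sdiff.1 hj).2 (h ▸ hcN), (mem_sdiff.1 hj).1⟩)
    refine ⟨fun v => bit (z v), ?_⟩
    have h := bit_gval_eq I hI hT hW.hN hW.hchord B.y hW.hT₁ B.C₁ B.G₁ hW.hjoin₁ hW.hcross₁ hzF
    rw [sum_eq_zero fun e he => ?_, add_zero] at h
    · rw [← h, hC1, hG1, hb1, hzR]
    · rw [coef_of_unread I (hunB _ (vars_mem_privs I he (s := 2) (by decide))).1, if_neg (hblindB _ (vars_mem_privs I he (s := 2) (by decide))),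
        coef_of_unread I (hunB _ (vars_mem_privs I he (s := 3) (by decide))).1, if_neg (hblindB _ (vars_mem_privs I he (s := 3) (by decide))),
        mul_zero, mul_zero, add_zero]

/-! ## Case B with two chords -/

/-- **Case B, at least two chords: `#J₀ ≤ 5`.**  Union-terminal core, admissible `F`, hun, `w₂` reads a chord private, `#(J₀ ∖ F) ≥ 2`. -/
theorem caseB_two_chords (I : LocalMap 4 n m) (hI : I.IsPure xorAndPred) (hT : Typed I) (hS : SimpleOverlap I) {r : ℕ} (hE : BoundaryExpanding r I)
    {y : Fin m → Bool} {J₀ : Finset (Fin m)} {A₀ A₁ w₂ : Finset (Fin n) × Finset (Fin m) × Bool} (hU : UnionTerminal I r y J₀ A₀ A₁ w₂)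
    {F : Finset (Fin m)} (hF : F ⊆ J₀) (hP : Peelable I F) (hmax : ∀ F', F ⊆ F' → F' ⊆ J₀ → Peelable I F' → F' = F)
    (hchord : ∀ e ∈ J₀ \ F, IsChord I J₀ e) (hun : ∀ g ∈ A₀.2.1 ∪ w₂.2.1, ∀ v ∈ privs I (J₀ \ F), I.vars g 2 ≠ v ∧ I.vars g 3 ≠ v)
    (hread : ∃ v ∈ privs I (J₀ \ F), v ∈ w₂.1) (htwo : 2 ≤ (J₀ \ F).card) : J₀.card ≤ 5 := by
  classical
  have hU' := hU
  obtain ⟨-, hX, hJr, hG, hd₀, hd₂, hcard, -, hn₀, hn₁, hcov⟩ := hU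
  -- a read chord `c₀` and another chord `c₁`
  obtain ⟨v, hv, hvw⟩ := hread
  obtain ⟨c₀, hc₀, hv'⟩ := (mem_privs I).1 hv
  have hread₀ : I.vars c₀ 2 ∈ w₂.1 ∨ I.vars c₀ 3 ∈ w₂.1 := by
    rcases hv' with h | h
    · left; rw [h]; exact hvw
    · right; rw [h]; exact hvw
  obtain ⟨c₁, hc₁, hne⟩ : ∃ c₁ ∈ J₀ \ F, c₁ ≠ c₀ := by
    obtain ⟨a, ha, b, hb, hab⟩ := one_lt_card.1 (by omega : 1 < (J₀ \ F).card)
    by_cases hac : a = c₀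
    · exact ⟨b, hb, fun h => hab (hac.trans h.symm)⟩
    · exact ⟨a, ha, hac⟩
  -- alignment and the reads of `w₂`
  obtain ⟨ε₀, ε₁, hal⟩ := alignment I hI hT hS hE hU' hF hP hmax hchord hun hc₀ hc₁ hne.symm hread₀
  have hall := chords_read_of_one I hI hT hS hE hU' hF hP hmax hchord hun hc₀ hread₀
  have hun₁ : ∀ g ∈ A₁.2.1 ∪ w₂.2.1, ∀ v ∈ privs I (J₀ \ F), I.vars g 2 ≠ v ∧ I.vars g 3 ≠ v := by rw [hG]; exact hun
  -- if a reader is released nowhere, the other pair is terminal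
  by_cases hP₀ : ∃ f ∈ J₀, SatPair I y (J₀.erase f) A₀ w₂
  swap
  · have hTm : Terminal I r y J₀ A₁ w₂ :=
      terminal_of_cover₁ I hU' fun f hf => (hcov f hf).resolve_left fun h => hP₀ ⟨f, hf, h⟩
    exact card_le_five_of_terminal' I hI hT hS hE y hTm hF hP hmax hchord hun₁
  by_cases hP₁ : ∃ f ∈ J₀, SatPair I y (J₀.erase f) A₁ w₂
  swap
  · have hTm : Terminal I r y J₀ A₀ w₂ :=
      terminal_of_cover₀ I hU' fun f hf => (hcov f hf).resolve_right fun h => hP₁ ⟨f, hf, h⟩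
    exact card_le_five_of_terminal' I hI hT hS hE y hTm hF hP hmax hchord hun
  -- the effective readers
  obtain ⟨R₀, hbl₀, hsub₀, hiff₀⟩ := exists_effReader I A₀ w₂ ε₀ fun c hc => (hal c hc).1
  obtain ⟨R₁, hbl₁, hsub₁, hiff₁⟩ := exists_effReader I A₁ w₂ ε₁ fun c hc => (hal c hc).2
  have hsub₁' : R₁.2.1 ⊆ A₀.2.1 ∪ w₂.2.1 := by rw [← hG]; exact hsub₁
  -- transfer of solvability
  have hsp : ∀ (A R : Finset (Fin n) × Finset (Fin m) × Bool),
      (∀ z : Fin n → Bool, gval I w₂.1 w₂.2.1 z = w₂.2.2 → (gval I A.1 A.2.1 z = A.2.2 ↔ gval I R.1 R.2.1 z = R.2.2)) →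
      ∀ E : Finset (Fin m), SatPair I y E A w₂ ↔ SatPair I y E R w₂ := by
    intro A R h E
    constructor
    · rintro ⟨z, hz, hA, hw⟩; exact ⟨z, hz, (h z hw).1 hA, hw⟩
    · rintro ⟨z, hz, hR, hw⟩; exact ⟨z, hz, (h z hw).2 hR, hw⟩
  -- the per-reader dichotomy
  have key : ∀ (A R : Finset (Fin n) × Finset (Fin m) × Bool),
      (∀ v ∈ privs I (J₀ \ F), v ∉ R.1) → R.2.1 ⊆ A₀.2.1 ∪ w₂.2.1 →
      (∀ z : Fin n → Bool, gval I w₂.1 w₂.2.1 z = w₂.2.2 → (gval I A.1 A.2.1 z = A.2.2 ↔ gval I R.1 R.2.1 z = R.2.2)) →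
      ¬ SatPair I y J₀ A w₂ → (∃ f ∈ J₀, SatPair I y (J₀.erase f) A w₂) →
      J₀.card ≤ 5 ∨ ∀ c ∈ J₀ \ F, ¬ SatPair I y (J₀.erase c) A w₂ := by
    intro A R hbl hsub hiff hT3A hrel
    have hdR : Disjoint J₀ R.2.1 := by
      rw [disjoint_left]
      intro g hg hgR
      rcases mem_union.1 (hsub hgR) with h | h
      · exact disjoint_left.1 hd₀ hg h
      · exact disjoint_left.1 hd₂ hg h
    have hcardR : (J₀ ∪ R.2.1 ∪ w₂.2.1).card ≤ r :=
      (card_le_card (union_subset (union_subset (subset_union_left.trans subset_union_left)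
        (hsub.trans (union_subset (subset_union_right.trans subset_union_left) subset_union_right))) subset_union_right)).trans hcard
    have hunR : ∀ g ∈ R.2.1 ∪ w₂.2.1, ∀ v ∈ privs I (J₀ \ F), I.vars g 2 ≠ v ∧ I.vars g 3 ≠ v := by
      intro g hg
      rcases mem_union.1 hg with h | h
      · exact hun g (hsub h)
      · exact hun g (mem_union_right _ h)
    have hT3R : ¬ SatPair I y J₀ R w₂ := fun h => hT3A ((hsp A R hiff J₀).2 h)
    obtain ⟨f, hf, hzf⟩ := hrel
    obtain ⟨z, -, hzR, hzw⟩ := (hsp A R hiff _).1 hzf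
    rcases reader_dichotomy I hI hT hS hE y hX hJr hF hP hmax hchord htwo R w₂ hdR hd₂ hcardR hunR hbl hall hT3R ⟨z, hzR, hzw⟩ with h | h
    · exact Or.inl h
    · exact Or.inr fun c hc hsc => h c hc ((hsp A R hiff _).1 hsc)
  rcases key A₀ R₀ hbl₀ hsub₀ hiff₀ hn₀ hP₀ with h | h₀
  · exact h
  rcases key A₁ R₁ hbl₁ hsub₁' hiff₁ hn₁ hP₁ with h | h₁
  · exact h
  -- both readers are released by no chord: the cover fails at `c₀`
  rcases hcov c₀ (mem_sdiff.1 hc₀).1 with h | h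
  · exact (h₀ c₀ hc₀ h).elim
  · exact (h₁ c₀ hc₀ h).elim

end Summit.PneNP.PneNP.Theorems.PstarUnionCaseBFiveTwo
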